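import Summits.BirchSwinnertonDyer.Rank1Residual.Additive.X3BranchKummerLayerUnitsSum
import Summits.BirchSwinnertonDyer.Rank1Residual.Additive.X3BranchResidualQuotSelmerLowerBound
import Summits.BirchSwinnertonDyer.Rank1Residual.Additive.X3BranchLayerOneCubicResidues
import HarnessLib

/-!
# X3, the DEGENERATE rows OFF the sub-locus: the U-side LOWER BOUND `3^{#ι} ≤ #U(W[3]/Φ₀)` from Kummer
# classes of `Σ₀`-units of the FIRST LAYER `ℚ_1 = ℚ(ζ₉)⁺`, with independence certified by CUBIC
# RESIDUES (cell `bsd-eis`, seat `bsd-eis-x3` gen 7; sequel of `X3BranchKummerLayerUnits.lean` and of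
# gen 6's `X3BranchResidualQuotSelmerLowerBound.lean` (rational units); route K1 `AdditiveBranchIMC`,
# crux `GordTwoRankZeroOffCaseOne` — supports only)

HONEST FRAMING (cell `bsd-eis`, `run/shared/lean/pub/bsd-eis/README.md` §4): the programme's target of
record is the full Birch–Swinnerton-Dyer formula for every `E/ℚ` of analytic rank `≤ 1`; this file is
the U-side of the degenerate certificate road (`X3BranchDegenerateEndStateCardGe.lean`: `hnge`) on the
rows with a prime `ℓ ≡ ±1 (mod 9)` in `Σ₀`, where `#U(μ₃) = 3^{Σ s_ℓ − 1}` exceeds what rational units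
give. THEOREMS ONLY (no `def`, no named fact, no `sorry`); nothing is booked; no label or count moves.

## Statement (`X3Branch.pow_card_le_natCard_residualQuotSelmer_of_trivialLine_layerOne`)

`κ` cyclotomic, `Φ₀` the trivial rational `3`-line (`Ψ = W[3]/Φ₀ ≅ μ₃`), `θ = ζ + ζ⁸` (`ζ` a primitive
`9`-th root of unity). DATA, all kernel-decidable per pair: for `i ∈ ι` the unit `a_i = P_i(θ)` and its
conjugates `P_i(θ²−2) = P'_i(θ)`, `P_i(−θ²−θ+2) = P''_i(θ)` (`P_i^{(j)} ∈ ℤ³`, identities in `ℚ̄`);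
cube certificates `P^{(j)}(θ)·D^{(j)}(θ)³ = 1 + 9T^{(j)}(θ)`; norms `P·P'·P''(θ) = n_i ∈ ℕ`, `n_i ≠ 0`,
primes of `n_i` under `Σ₀`; and an INDEPENDENCE CERTIFICATE: auxiliary primes `q_ρ ≡ 1 (mod 3)` with
the three roots `r_{ρ,k}` of `X³ − 3X + 1 (mod q_ρ)` and a Vandermonde inverse `w_ρ`, a cube root of
unity `ω_ρ ≠ 1` in `𝔽_{q_ρ}`, exponents `e_{ρ,i}` with `P_i(r_{ρ,0})^{(q_ρ−1)/3} = ω_ρ^{e_{ρ,i}}`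
(`P_i(r_{ρ,0}) ≠ 0`), and a left inverse `L` of `e` modulo `3`. THEN `3^{#ι} ≤ #U`.

## Proof

Classes: the Kummer cocycles `f_i` of the `a_i` on `ker κ` w.r.t. good cube roots (`exists_goodRoot`),
summed: `F_k = Σ k_i f_i`, `k ∈ 𝔽₃^ι`; membership in `U` through the conjugate representatives
`Σ k_i f^τ_i` (`conjH1_eq_of_kummer` / `class_eq_of_root_mul_pow` for the products `∏ β_i^{k_i}`; local
vanishing as in `kummerClass_mem_unramifiedSelmer`). Injectivity: `[F_d] = 0` ⟹ `γ³ = A = ∏ a_i^{d_i}`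
with `γ` fixed by `ker κ` (`exists_fixed_root_of_coboundary`) ⟹ fixed by `κ⁻¹(3ℤ₃)`
(`smul_eq_self_of_fixed_kerSubgroup`) ⟹ `mγ = G(θ)`, `G ∈ ℤ[X]` of degree `≤ 2`, `m ≥ 1` MINIMAL
(`exists_intCombination_of_fixed`) ⟹ `m³·∏P_i^{d_i} ≡ G³ (mod X³ − 3X + 1)` in `ℤ[X]` ⟹ at every
root `r` of the cubic mod `q_ρ`: `m³ ∏ P_i(r)^{d_i} = G(r)³` in `𝔽_q` (`eval₂_eq_of_aeval_eq`);
`q ∤ m` (else `G(r_k) = 0` at three distinct roots, `G ≡ 0 (mod q)` by the Vandermonde inverse, and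
`(m/q)γ = (G/q)(θ)` contradicts minimality) ⟹ `∏ P_i(r)^{d_i}` is a cube in `𝔽_qˣ` ⟹ raised to
`(q−1)/3`: `ω^{Σ e_{ρ,i} d_i} = 1` ⟹ `Σ_i e_{ρ,i} d_i ≡ 0 (mod 3)` ⟹ (left inverse) `d = 0`.

References: [GreenbergVatsal2000] §2 pp. 28–30; [SerreLocalFields1979] Ch. X §3; [Washington1997]
§13.1; [IrelandRosen1990] Ch. 9 §1 (cubic residue character); cell file
`run/shared/lean/pub/bsd-eis/x3-MEMO-9.md` §2.4 (e).
-/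

set_option autoImplicit false

noncomputable section

open scoped Classical AddSubgroup NumberField

namespace Summit.BirchSwinnertonDyer.Rank1Residual.Additive

open NumberField IsDedekindDomain Field WeierstrassCurve Polynomial
  Literature.NumberTheory.GaloisRepresentations
  Literature.NumberTheory.EllipticCurves
  Literature.NumberTheory.EllipticCurves.GreenbergSelmer
  Literature.NumberTheory.EllipticCurves.GreenbergVatsal2000
  Literature.NumberTheory.EllipticCurves.Rank1Residual
  Literature.NumberTheory.NumberFields
  Summit.BirchSwinnertonDyer.Rank1Residual.X2.ResidualDevissageModules
  Summit.BirchSwinnertonDyer.Rank1Residual.X2.ResidualDevissageLine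
  Summit.BirchSwinnertonDyer.Rank1Residual.Iwasawa.CyclotomicLayerOne
  KummerLineClasses KummerLayerClasses

/-! ### §2 The LOWER BOUND for `#U` from layer-one units -/

section Main

open KummerLayerClasses

variable {W : WeierstrassCurve ℚ} [W.IsElliptic]

/-- **LOWER BOUND for GV's `U(W[3]/Φ₀)` on the DEGENERATE rows from Kummer classes of `Σ₀`-units of
the first layer `ℚ_1 = ℚ(θ)`, `θ = ζ + ζ⁸`.** See the module docstring for the data and the proof.
`3^{#ι} ≤ #U` (`residualQuotSelmer`, assumed finite). [cite: GreenbergVatsal2000, §2 pp. 28–30]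
[cite: SerreLocalFields1979, Ch. X §3] [cite: Washington1997, §13.1] -/
theorem _root_.Summit.BirchSwinnertonDyer.Rank1Residual.Additive.X3Branch.pow_card_le_natCard_residualQuotSelmer_of_trivialLine_layerOne
    [hp : Fact (Nat.Prime 3)] (κ : ZpExtension ℚ 3) (hκ : κ.IsCyclotomic)
    (S₀ : Finset (HeightOneSpectrum (𝓞 ℚ)))
    {Φ₀ : AddSubgroup (W.geomTorsion ((3 : ℕ) : ℤ))} (hΦ : IsRationalLine W 3 Φ₀)
    (htriv : ∀ (σ : absoluteGaloisGroup ℚ) (Pt : geomTorsion W ((3 : ℕ) : ℤ)), Pt ∈ Φ₀ → σ • Pt = Pt)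
    {ζ : AlgebraicClosure ℚ} (hζ : IsPrimitiveRoot ζ 9)
    {ι : Type} [Fintype ι] [DecidableEq ι]
    -- the units `a_i = P_i⁽⁰⁾(θ)` and their conjugates `P_i⁽¹⁾(θ) = P_i⁽⁰⁾(θ²−2)`, `P_i⁽²⁾(θ) = P_i⁽⁰⁾(−θ²−θ+2)`
    (P : ι → Fin 3 → Fin 3 → ℤ)
    (hconj1 : ∀ i, (P i 0 0 : AlgebraicClosure ℚ) + P i 0 1 * ((ζ + ζ ^ 8) ^ 2 - 2) +
      P i 0 2 * ((ζ + ζ ^ 8) ^ 2 - 2) ^ 2 =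
      (P i 1 0 : AlgebraicClosure ℚ) + P i 1 1 * (ζ + ζ ^ 8) + P i 1 2 * (ζ + ζ ^ 8) ^ 2)
    (hconj2 : ∀ i, (P i 0 0 : AlgebraicClosure ℚ) + P i 0 1 * (-(ζ + ζ ^ 8) ^ 2 - (ζ + ζ ^ 8) + 2) +
      P i 0 2 * (-(ζ + ζ ^ 8) ^ 2 - (ζ + ζ ^ 8) + 2) ^ 2 =
      (P i 2 0 : AlgebraicClosure ℚ) + P i 2 1 * (ζ + ζ ^ 8) + P i 2 2 * (ζ + ζ ^ 8) ^ 2)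
    -- local cube certificates for every conjugate
    (D T : ι → Fin 3 → Fin 3 → ℤ)
    (hcube : ∀ i j, ((P i j 0 : AlgebraicClosure ℚ) + P i j 1 * (ζ + ζ ^ 8) + P i j 2 * (ζ + ζ ^ 8) ^ 2) *
      ((D i j 0 : AlgebraicClosure ℚ) + D i j 1 * (ζ + ζ ^ 8) + D i j 2 * (ζ + ζ ^ 8) ^ 2) ^ 3 =
      1 + 9 * ((T i j 0 : AlgebraicClosure ℚ) + T i j 1 * (ζ + ζ ^ 8) + T i j 2 * (ζ + ζ ^ 8) ^ 2))
    -- norms supported on `Σ₀`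
    (n : ι → ℕ) (hn0 : ∀ i, n i ≠ 0)
    (hnorm : ∀ i, ((P i 0 0 : AlgebraicClosure ℚ) + P i 0 1 * (ζ + ζ ^ 8) + P i 0 2 * (ζ + ζ ^ 8) ^ 2) *
      (((P i 1 0 : AlgebraicClosure ℚ) + P i 1 1 * (ζ + ζ ^ 8) + P i 1 2 * (ζ + ζ ^ 8) ^ 2) *
        ((P i 2 0 : AlgebraicClosure ℚ) + P i 2 1 * (ζ + ζ ^ 8) + P i 2 2 * (ζ + ζ ^ 8) ^ 2)) = n i)
    (hnS : ∀ i (v : HeightOneSpectrum (𝓞 ℚ)), ((n i : ℕ) : 𝓞 ℚ) ∈ v.asIdeal → v ∈ S₀)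
    -- the independence certificate (cubic residues at auxiliary primes `q ≡ 1 (mod 3)`)
    {R : ℕ} (q : Fin R → ℕ) (hq : ∀ ρ, (q ρ).Prime) (hq1 : ∀ ρ, 3 ∣ q ρ - 1)
    (r : (ρ : Fin R) → Fin 3 → ZMod (q ρ)) (hr : ∀ ρ kk, r ρ kk ^ 3 - 3 * r ρ kk + 1 = 0)
    (w : (ρ : Fin R) → Fin 3 → Fin 3 → ZMod (q ρ))
    (hw : ∀ ρ (c c' : Fin 3), ∑ kk, w ρ c kk * r ρ kk ^ c'.val = if c = c' then 1 else 0)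
    (ω : (ρ : Fin R) → ZMod (q ρ)) (hω : ∀ ρ, ω ρ ^ 3 = 1 ∧ ω ρ ≠ 1)
    (e : Fin R → ι → ℕ)
    (he : ∀ ρ i, ((P i 0 0 : ZMod (q ρ)) + (P i 0 1 : ZMod (q ρ)) * r ρ 0 +
      (P i 0 2 : ZMod (q ρ)) * r ρ 0 ^ 2) ^ ((q ρ - 1) / 3) = ω ρ ^ e ρ i)
    (hnz : ∀ ρ i, (P i 0 0 : ZMod (q ρ)) + (P i 0 1 : ZMod (q ρ)) * r ρ 0 +
      (P i 0 2 : ZMod (q ρ)) * r ρ 0 ^ 2 ≠ 0)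
    (L : ι → Fin R → ℤ)
    (hL : ∀ i i', (∑ ρ, (L i ρ : ZMod 3) * (e ρ i' : ZMod 3)) = if i = i' then 1 else 0)
    [Finite (residualQuotSelmer W 3 κ S₀ Φ₀ hΦ)] :
    3 ^ Fintype.card ι ≤ Nat.card (residualQuotSelmer W 3 κ S₀ Φ₀ hΦ) := by
  haveI : NeZero ((3 : ℕ) : ℚ) := ⟨by norm_num⟩
  haveI : ∀ ρ, Fact (q ρ).Prime := fun ρ ↦ ⟨hq ρ⟩
  set θ : AlgebraicClosure ℚ := ζ + ζ ^ 8 with hθdef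
  have hθ : θ ^ 3 = 3 * θ - 1 := by linear_combination theta_cubic hζ
  have hζ₃ : IsPrimitiveRoot (ζ ^ 3) 3 := hζ.pow (by norm_num) (by norm_num)
  -- the `ω`-line `Ψ = W[3]/Φ₀` with a generator `y₀`
  have hΨ := quot_smul_eq_cyclotomic_of_trivialLine (p := 3) hΦ htriv
  obtain ⟨y₀, hy₀, hgen⟩ := exists_generator_quot (p := 3) hΦ
  have hy₀3 : 3 • y₀ = 0 := by
    have h := addOrderOf_nsmul_eq_zero y₀
    rwa [hy₀] at h
  -- `θ` is fixed by `κ⁻¹(3ℤ₃) ⊇ ker κ`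
  have hG1θ : ∀ σ ∈ κ.layerSubgroup 1, σ • θ = θ := by
    intro σ hσ
    have hmem := zeta_add_pow_mem_layer_one hκ ζ hζ.pow_eq_one
    rw [ZpExtension.layer, IntermediateField.mem_fixedField_iff] at hmem
    exact hmem _ (Subgroup.mem_map.mpr ⟨σ, hσ, rfl⟩)
  have hkerθ : ∀ σ ∈ κ.kerSubgroup, σ • θ = θ := fun σ hσ ↦
    hG1θ σ (κ.kerSubgroup_le_layerSubgroup 1 hσ)
  -- the units
  set a : ι → AlgebraicClosure ℚ := fun i ↦ (P i 0 0 : AlgebraicClosure ℚ) + P i 0 1 * θ + P i 0 2 * θ ^ 2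
    with hadef
  have ha0 : ∀ i, a i ≠ 0 := fun i h0 ↦ hn0 i (by
    have := hnorm i
    rw [show ((P i 0 0 : AlgebraicClosure ℚ) + P i 0 1 * (ζ + ζ ^ 8) + P i 0 2 * (ζ + ζ ^ 8) ^ 2) = a i
      from rfl, h0, zero_mul] at this
    exact_mod_cast this.symm)
  have hG1a : ∀ i, ∀ σ ∈ κ.layerSubgroup 1, σ • a i = a i := fun i σ hσ ↦ by
    change σ • ((P i 0 0 : AlgebraicClosure ℚ) + P i 0 1 * θ + P i 0 2 * θ ^ 2) = _
    rw [smul_eval_theta, hG1θ σ hσ]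
  have hkera : ∀ i, ∀ σ ∈ κ.kerSubgroup, σ • a i = a i := fun i σ hσ ↦
    hG1a i σ (κ.kerSubgroup_le_layerSubgroup 1 hσ)
  -- good cube roots and Kummer cocycles on `ker κ`
  choose β hβ hβfix using fun i ↦ exists_goodRoot hθ (P i 0) (D i 0) (T i 0) (hcube i 0)
  have hβ' : ∀ i, β i ^ 3 = a i := fun i ↦ hβ i
  have hβ0 : ∀ i, β i ≠ 0 := fun i h0 ↦ by
    have := hβ' i; rw [h0, zero_pow three_ne_zero] at this; exact ha0 i this.symm
  choose f hfc hfcoc hfrel using fun i ↦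
    exists_kummerCocycle (p := 3) κ.kerSubgroup hΨ y₀ hy₀3 hζ₃ (ha0 i) (hkera i) (hβ' i)
  -- `3`-torsion bookkeeping in `Ψ`
  have h3Ψ : ∀ y : (lineSub Φ₀ hΦ).Quot, 3 • y = 0 := fun y ↦ by
    obtain ⟨t, rfl⟩ := hgen y
    rw [← mul_nsmul, mul_comm, mul_nsmul, hy₀3, nsmul_zero]
  have hmodΨ : ∀ (y : (lineSub Φ₀ hΦ).Quot) (u v : ℕ), (u : ZMod 3) = v → u • y = v • y :=
    fun y u v h ↦ by
      rw [nsmul_eq_mod_nsmul u (h3Ψ y), nsmul_eq_mod_nsmul v (h3Ψ y),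
        (ZMod.natCast_eq_natCast_iff' u v 3).mp h]
  have hsubΨ : ∀ (y : (lineSub Φ₀ hΦ).Quot) (k k' : ZMod 3),
      k.val • y - k'.val • y = (k - k').val • y := fun y k k' ↦ by
    rw [sub_eq_iff_eq_add, ← add_nsmul]
    apply hmodΨ
    push_cast
    simp only [ZMod.natCast_val, ZMod.cast_id', id_eq, sub_add_cancel]
  -- the combinations `F k = Σ k_i f_i`
  set F : (ι → ZMod 3) → absoluteGaloisGroup ℚ → (lineSub Φ₀ hΦ).Quot :=
    fun k σ ↦ ∑ i, (k i).val • f i σ with hFdef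
  haveI : ContinuousAdd (lineSub Φ₀ hΦ).Quot := ⟨continuous_of_discreteTopology⟩
  have hFc : ∀ k, Continuous (F k) := fun k ↦
    continuous_finsetSum _ fun i _ ↦ (continuous_nsmul (k i).val).comp (hfc i)
  have hFcoc : ∀ k, ∀ σ ∈ κ.kerSubgroup, ∀ τ ∈ κ.kerSubgroup, F k (σ * τ) = F k σ + σ • F k τ :=
    fun k σ hσ τ hτ ↦ by
      simp only [hFdef, hfcoc _ σ hσ τ hτ, nsmul_add, Finset.sum_add_distrib, Finset.smul_sum, smul_comm σ]
  have hFrel : ∀ k, ∀ σ ∈ κ.kerSubgroup, ∃ m : ℕ,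
      σ • (∏ i, β i ^ (k i).val) = (ζ ^ 3) ^ m * ∏ i, β i ^ (k i).val ∧ F k σ = m • y₀ :=
    fun k σ hσ ↦ rel_sum_at Finset.univ y₀ β f σ (fun i _ ↦ hfrel i σ hσ) (fun i ↦ (k i).val)
  have hFsub : ∀ k k' σ, F k σ - F k' σ = F (k - k') σ := fun k k' σ ↦ by
    simp only [hFdef, ← Finset.sum_sub_distrib, hsubΨ, Pi.sub_apply]
  -- the classes `c k = [F k|_{G_{ℚ_∞}}]`
  choose Fc cls hFc1 hcls using fun k ↦
    exists_class_of_cocycle κ.kerSubgroup le_rfl (F k) (hFc k) (hFcoc k)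
  -- MEMBERSHIP in `U` (`X3BranchKummerLayerUnitsSum.lean`)
  have hmem : ∀ k, cls k ∈ unramifiedSelmer κ.kerSubgroup (lineSub Φ₀ hΦ).Quot 3
      (↑S₀ : Set (HeightOneSpectrum (𝓞 ℚ))) := fun k ↦ by
    rw [hcls k]
    exact kummerSumClass_mem_unramifiedSelmer κ hκ S₀ hΨ hy₀3 hζ P hconj1 hconj2 D T hcube n hn0
      hnorm hnS β hβ' (fun i ↦ (k i).val) (Fc k)
      (fun h ↦ by
        obtain ⟨m, hm, hFm⟩ := hFrel k h h.2
        exact ⟨m, hm, by rw [hFc1]; exact hFm⟩)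
  -- INJECTIVITY: a vanishing class forces `d = 0`
  have hzero : ∀ d : ι → ZMod 3, cls d = 0 → d = 0 := by
    intro d hd
    rw [hcls d, oneCocycleClass_eq_zero_iff] at hd
    obtain ⟨y, hy⟩ := hd
    have hcob : ∀ h ∈ κ.kerSubgroup, F d h = h • y - y := fun h hh ↦ by
      have := hy ⟨h, hh⟩
      rw [hFc1 d ⟨h, hh⟩] at this
      exact this
    set A : AlgebraicClosure ℚ := ∏ i, a i ^ (d i).val with hA
    have hA0 : A ≠ 0 := Finset.prod_ne_zero_iff.mpr fun i _ ↦ pow_ne_zero _ (ha0 i)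
    have hBA : (∏ i, β i ^ (d i).val) ^ 3 = A := by
      rw [← Finset.prod_pow, hA]
      exact Finset.prod_congr rfl fun i _ ↦ by rw [← pow_mul, mul_comm, pow_mul, hβ' i]
    obtain ⟨γ, hγ, hγfix⟩ := KummerLayerClasses.exists_fixed_root_of_coboundary (p := 3) hΨ hy₀ hgen hζ₃
      hBA (hFrel d) κ.kerSubgroup le_rfl hcob
    -- `γ` is fixed by `κ⁻¹(3ℤ₃)`
    have hAG : ∀ σ ∈ κ.layerSubgroup 1, σ • A = A := fun σ hσ ↦ by
      rw [hA, Finset.smul_prod']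
      exact Finset.prod_congr rfl fun i _ ↦ by rw [smul_pow', hG1a i σ hσ]
    have hγG : ∀ σ ∈ κ.layerSubgroup 1, σ • γ = γ := fun σ hσ ↦
      smul_eq_self_of_fixed_kerSubgroup (p := 3) (by decide) κ hζ₃ hA0 hγ hAG hγfix hσ
    exact eq_zero_of_cube_eq_prod_layerOne hκ hζ (fun i ↦ P i 0) (by rw [hγ, hA]) hγG q hq hq1 r hr w hw ω hω
      e he hnz L hL
  -- COUNTING
  haveI hfin : Finite (unramifiedSelmer κ.kerSubgroup (lineSub Φ₀ hΦ).Quot 3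
      (↑S₀ : Set (HeightOneSpectrum (𝓞 ℚ)))) := ‹Finite (residualQuotSelmer W 3 κ S₀ Φ₀ hΦ)›
  let Fmap : (ι → ZMod 3) → unramifiedSelmer κ.kerSubgroup (lineSub Φ₀ hΦ).Quot 3
      (↑S₀ : Set (HeightOneSpectrum (𝓞 ℚ))) := fun k ↦ ⟨cls k, hmem k⟩
  have hinj : Function.Injective Fmap := by
    intro k k' hkk'
    have h1 : cls k = cls k' := congrArg Subtype.val hkk'
    have h2 : cls (k - k') = 0 := by
      have e' : Fc k - Fc k' = Fc (k - k') := by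
        apply Subtype.ext
        ext h
        change (Fc k).1 h - (Fc k').1 h = (Fc (k - k')).1 h
        rw [hFc1, hFc1, hFc1, hFsub]
      rw [hcls, ← e', oneCocycleClass_sub, ← hcls, ← hcls, h1, sub_self]
    exact sub_eq_zero.mp (hzero _ h2)
  have hcard := Nat.card_le_card_of_injective Fmap hinj
  rw [Nat.card_fun, Nat.card_zmod, Nat.card_eq_fintype_card] at hcard
  exact hcard

end Main

end Summit.BirchSwinnertonDyer.Rank1Residual.Additive

end
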